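import Summits.CriticalPhenomena.PercolationContinuityZ3.Theorems.PercNearOneGluingNoHeavyLowerTailCubicThreePointSections
import HarnessLib

/-!
# `NoHeavyLowerTail` (stmt-CriticalPhenomena-4575) — SHK3⁺ / 3PT-LB terminal-edge induction, part 2: the five apex transition identities

Support file (prover prim-ineq-prove-2 gen 2; `--supports stmt-CriticalPhenomena-4575`), continuing `…CubicThreePointSections`.
With `x` joined to the apex terminal `a` in every configuration (`hax`) and `K' = K ∪ {{x,m}}`, the cells of the law with forced set `K'`
are the cells of the law with forced set `K` moved by exactly five transition masses:
`q' = q − α₁ − α₂` (`trans_Q`), `u₁' + β₁ = u₁ + α₁` (`trans_U₁`), `u₂' + β₂ = u₂ + α₂` (`trans_U₂`), `u₃' + β₃ = u₃` (`trans_U₃`),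
`t' = t + β₁ + β₂ + β₃` (`trans_T`), where `α₁ = PrW(evQ K ∩ evU₁ K')` (from `a|b|c` the edge lets `a` join `b`), `α₂ = PrW(evQ K ∩ evU₂ K')`,
`βᵢ = PrW(evUᵢ K ∩ evT K')`.  (No configuration goes `a|b|c → bc|a`, `a|b|c → abc`, and cells never split.)  Each identity is a pointwise
indicator identity summed with the weights (`PrW_of_ind_add*`).  Memo: run/shared/lean/prim/prim-ineq-prove-2/MEMO-7-3PTLB-INDUCTION.md §2.
[cite: GladkovZimin2024HK, §4 (coordinate induction)]
-/

noncomputable section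

namespace Summit.CriticalPhenomena.PercolationContinuityZ3.Theorems

namespace CubicThreePointStep

open Finset SimpleGraph Literature.Probability.Percolation.DecisionTree

variable {V : Type*} [DecidableEq V]

/-! ### The apex transitions as mass identities -/

section Transitions

variable (D : Finset (Sym2 V)) (p : Sym2 V → ℝ) {K : Finset (Sym2 V)} {a b c x m : V}
  (hax : ∀ S : Finset (Sym2 V), R K S a x)
include hax

/-- `q¹ = q⁰ − α₁ − α₂`: from `a|b|c`, forcing the apex edge leads to `a|b|c`, `ab|c` or `ac|b` only. [folklore] -/
theorem trans_Q :
    PrW D p (evQ K a b c) = PrW D p (evQ (insert s(x, m) K) a b c) +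
      PrW D p (evQ K a b c ∩ evU₁ (insert s(x, m) K) a b c) +
      PrW D p (evQ K a b c ∩ evU₂ (insert s(x, m) K) a b c) := by
  refine PrW_of_ind_add3 D p fun S _ => ?_
  by_cases hq : S ∈ evQ K a b c
  · rw [ind_of_mem hq]
    obtain ⟨hab0, hac0, hbc0⟩ := hq
    have hbc1 : ¬ R (insert s(x, m) K) S b c := by
      intro hbc1
      obtain ⟨hab1, hac1⟩ := gain_bc (hax S) hbc1 hbc0
      exact hbc0 (gain_both (hax S) hab1 hab0 hac1 hac0)
    by_cases hab1 : R (insert s(x, m) K) S a b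
    · have hac1 : ¬ R (insert s(x, m) K) S a c := fun hac1 => hbc1 (hab1.symm.trans hac1)
      rw [ind_of_not_mem (fun h : S ∈ evQ _ a b c => h.1 hab1),
        ind_of_mem (show S ∈ evQ K a b c ∩ evU₁ _ a b c from ⟨⟨hab0, hac0, hbc0⟩, hab1, hac1⟩),
        ind_of_not_mem (fun h : S ∈ evQ K a b c ∩ evU₂ _ a b c => h.2.2 hab1)]
      ring
    · by_cases hac1 : R (insert s(x, m) K) S a c
      · rw [ind_of_not_mem (fun h : S ∈ evQ _ a b c => h.2.1 hac1),
          ind_of_not_mem (fun h : S ∈ evQ K a b c ∩ evU₁ _ a b c => h.2.2 hac1),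
          ind_of_mem (show S ∈ evQ K a b c ∩ evU₂ _ a b c from ⟨⟨hab0, hac0, hbc0⟩, hac1, hab1⟩)]
        ring
      · rw [ind_of_mem (show S ∈ evQ _ a b c from ⟨hab1, hac1, hbc1⟩),
          ind_of_not_mem (fun h : S ∈ evQ K a b c ∩ evU₁ _ a b c => hab1 h.2.1),
          ind_of_not_mem (fun h : S ∈ evQ K a b c ∩ evU₂ _ a b c => hac1 h.2.1)]
        ring
  · rw [ind_of_not_mem hq, ind_of_not_mem (fun h : S ∈ evQ K a b c ∩ evU₁ _ a b c => hq h.1),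
      ind_of_not_mem (fun h : S ∈ evQ K a b c ∩ evU₂ _ a b c => hq h.1)]
    have : S ∉ evQ (insert s(x, m) K) a b c := by
      intro h
      exact hq ⟨fun h' => h.1 (R_mono_insert _ h'), fun h' => h.2.1 (R_mono_insert _ h'),
        fun h' => h.2.2 (R_mono_insert _ h')⟩
    rw [ind_of_not_mem this]; ring

omit hax in
/-- `u₁¹ = u₁⁰ + α₁ − β₁` (cell `ab|c`), in the form `u₁¹ + β₁ = u₁⁰ + α₁`. [folklore] -/
theorem trans_U₁ :
    PrW D p (evU₁ (insert s(x, m) K) a b c) + PrW D p (evU₁ K a b c ∩ evT (insert s(x, m) K) a b c) =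
      PrW D p (evU₁ K a b c) + PrW D p (evQ K a b c ∩ evU₁ (insert s(x, m) K) a b c) := by
  have h1 : PrW D p (evU₁ (insert s(x, m) K) a b c) =
      PrW D p (evU₁ K a b c ∩ evU₁ (insert s(x, m) K) a b c) +
        PrW D p (evQ K a b c ∩ evU₁ (insert s(x, m) K) a b c) := by
    refine PrW_of_ind_add D p fun S _ => ?_
    by_cases h : S ∈ evU₁ (insert s(x, m) K) a b c
    · obtain ⟨hab1, hac1⟩ := h
      have hac0 : ¬ R K S a c := fun h' => hac1 (R_mono_insert _ h')
      have hbc0 : ¬ R K S b c := fun h' => hac1 (hab1.trans (R_mono_insert _ h'))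
      rw [ind_of_mem (show S ∈ evU₁ _ a b c from ⟨hab1, hac1⟩)]
      by_cases hab0 : R K S a b
      · rw [ind_of_mem (show S ∈ evU₁ K a b c ∩ evU₁ _ a b c from ⟨⟨hab0, hac0⟩, hab1, hac1⟩),
          ind_of_not_mem (fun h : S ∈ evQ K a b c ∩ evU₁ _ a b c => h.1.1 hab0)]; ring
      · rw [ind_of_not_mem (fun h : S ∈ evU₁ K a b c ∩ evU₁ _ a b c => hab0 h.1.1),
          ind_of_mem (show S ∈ evQ K a b c ∩ evU₁ _ a b c from ⟨⟨hab0, hac0, hbc0⟩, hab1, hac1⟩)]; ring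
    · rw [ind_of_not_mem h, ind_of_not_mem (fun h' : S ∈ evU₁ K a b c ∩ evU₁ _ a b c => h h'.2),
        ind_of_not_mem (fun h' : S ∈ evQ K a b c ∩ evU₁ _ a b c => h h'.2)]; ring
  have h2 : PrW D p (evU₁ K a b c) =
      PrW D p (evU₁ K a b c ∩ evU₁ (insert s(x, m) K) a b c) +
        PrW D p (evU₁ K a b c ∩ evT (insert s(x, m) K) a b c) := by
    refine PrW_of_ind_add D p fun S _ => ?_
    by_cases h : S ∈ evU₁ K a b c
    · obtain ⟨hab0, hac0⟩ := h
      have hab1 : R (insert s(x, m) K) S a b := R_mono_insert _ hab0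
      rw [ind_of_mem (show S ∈ evU₁ K a b c from ⟨hab0, hac0⟩)]
      by_cases hac1 : R (insert s(x, m) K) S a c
      · rw [ind_of_not_mem (fun h : S ∈ evU₁ K a b c ∩ evU₁ _ a b c => h.2.2 hac1),
          ind_of_mem (show S ∈ evU₁ K a b c ∩ evT _ a b c from ⟨⟨hab0, hac0⟩, hab1, hac1⟩)]; ring
      · rw [ind_of_mem (show S ∈ evU₁ K a b c ∩ evU₁ _ a b c from ⟨⟨hab0, hac0⟩, hab1, hac1⟩),
          ind_of_not_mem (fun h : S ∈ evU₁ K a b c ∩ evT _ a b c => hac1 h.2.2)]; ring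
    · rw [ind_of_not_mem h, ind_of_not_mem (fun h' : S ∈ evU₁ K a b c ∩ evU₁ _ a b c => h h'.1),
        ind_of_not_mem (fun h' : S ∈ evU₁ K a b c ∩ evT _ a b c => h h'.1)]; ring
  rw [h1, h2]; ring

omit hax in
/-- `u₂¹ + β₂ = u₂⁰ + α₂` (cell `ac|b`). [folklore] -/
theorem trans_U₂ :
    PrW D p (evU₂ (insert s(x, m) K) a b c) + PrW D p (evU₂ K a b c ∩ evT (insert s(x, m) K) a b c) =
      PrW D p (evU₂ K a b c) + PrW D p (evQ K a b c ∩ evU₂ (insert s(x, m) K) a b c) := by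
  have h1 : PrW D p (evU₂ (insert s(x, m) K) a b c) =
      PrW D p (evU₂ K a b c ∩ evU₂ (insert s(x, m) K) a b c) +
        PrW D p (evQ K a b c ∩ evU₂ (insert s(x, m) K) a b c) := by
    refine PrW_of_ind_add D p fun S _ => ?_
    by_cases h : S ∈ evU₂ (insert s(x, m) K) a b c
    · obtain ⟨hac1, hab1⟩ := h
      have hab0 : ¬ R K S a b := fun h' => hab1 (R_mono_insert _ h')
      have hbc0 : ¬ R K S b c := fun h' => hab1 (hac1.trans (R_mono_insert _ h').symm)
      rw [ind_of_mem (show S ∈ evU₂ _ a b c from ⟨hac1, hab1⟩)]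
      by_cases hac0 : R K S a c
      · rw [ind_of_mem (show S ∈ evU₂ K a b c ∩ evU₂ _ a b c from ⟨⟨hac0, hab0⟩, hac1, hab1⟩),
          ind_of_not_mem (fun h : S ∈ evQ K a b c ∩ evU₂ _ a b c => h.1.2.1 hac0)]; ring
      · rw [ind_of_not_mem (fun h : S ∈ evU₂ K a b c ∩ evU₂ _ a b c => hac0 h.1.1),
          ind_of_mem (show S ∈ evQ K a b c ∩ evU₂ _ a b c from ⟨⟨hab0, hac0, hbc0⟩, hac1, hab1⟩)]; ring
    · rw [ind_of_not_mem h, ind_of_not_mem (fun h' : S ∈ evU₂ K a b c ∩ evU₂ _ a b c => h h'.2),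
        ind_of_not_mem (fun h' : S ∈ evQ K a b c ∩ evU₂ _ a b c => h h'.2)]; ring
  have h2 : PrW D p (evU₂ K a b c) =
      PrW D p (evU₂ K a b c ∩ evU₂ (insert s(x, m) K) a b c) +
        PrW D p (evU₂ K a b c ∩ evT (insert s(x, m) K) a b c) := by
    refine PrW_of_ind_add D p fun S _ => ?_
    by_cases h : S ∈ evU₂ K a b c
    · obtain ⟨hac0, hab0⟩ := h
      have hac1 : R (insert s(x, m) K) S a c := R_mono_insert _ hac0
      rw [ind_of_mem (show S ∈ evU₂ K a b c from ⟨hac0, hab0⟩)]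
      by_cases hab1 : R (insert s(x, m) K) S a b
      · rw [ind_of_not_mem (fun h : S ∈ evU₂ K a b c ∩ evU₂ _ a b c => h.2.2 hab1),
          ind_of_mem (show S ∈ evU₂ K a b c ∩ evT _ a b c from ⟨⟨hac0, hab0⟩, hab1, hac1⟩)]; ring
      · rw [ind_of_mem (show S ∈ evU₂ K a b c ∩ evU₂ _ a b c from ⟨⟨hac0, hab0⟩, hac1, hab1⟩),
          ind_of_not_mem (fun h : S ∈ evU₂ K a b c ∩ evT _ a b c => hab1 h.2.1)]; ring
    · rw [ind_of_not_mem h, ind_of_not_mem (fun h' : S ∈ evU₂ K a b c ∩ evU₂ _ a b c => h h'.1),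
        ind_of_not_mem (fun h' : S ∈ evU₂ K a b c ∩ evT _ a b c => h h'.1)]; ring
  rw [h1, h2]; ring

/-- `u₃¹ + β₃ = u₃⁰` (cell `bc|a`: no configuration enters it through the apex edge). [folklore] -/
theorem trans_U₃ :
    PrW D p (evU₃ (insert s(x, m) K) a b c) + PrW D p (evU₃ K a b c ∩ evT (insert s(x, m) K) a b c) =
      PrW D p (evU₃ K a b c) := by
  symm
  refine PrW_of_ind_add D p fun S _ => ?_
  by_cases h : S ∈ evU₃ K a b c
  · obtain ⟨hbc0, hab0⟩ := h
    have hbc1 : R (insert s(x, m) K) S b c := R_mono_insert _ hbc0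
    rw [ind_of_mem (show S ∈ evU₃ K a b c from ⟨hbc0, hab0⟩)]
    by_cases hab1 : R (insert s(x, m) K) S a b
    · rw [ind_of_not_mem (fun h : S ∈ evU₃ _ a b c => h.2 hab1),
        ind_of_mem (show S ∈ evU₃ K a b c ∩ evT _ a b c from ⟨⟨hbc0, hab0⟩, hab1, hab1.trans hbc1⟩)]; ring
    · rw [ind_of_mem (show S ∈ evU₃ _ a b c from ⟨hbc1, hab1⟩),
        ind_of_not_mem (fun h : S ∈ evU₃ K a b c ∩ evT _ a b c => hab1 h.2.1)]; ring
  · rw [ind_of_not_mem h, ind_of_not_mem (fun h' : S ∈ evU₃ K a b c ∩ evT _ a b c => h h'.1)]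
    have : S ∉ evU₃ (insert s(x, m) K) a b c := by
      rintro ⟨hbc1, hab1⟩
      have hab0 : ¬ R K S a b := fun h' => hab1 (R_mono_insert _ h')
      by_cases hbc0 : R K S b c
      · exact h ⟨hbc0, hab0⟩
      · exact hab1 (gain_bc (hax S) hbc1 hbc0).1
    rw [ind_of_not_mem this]; ring

/-- `t¹ = t⁰ + β₁ + β₂ + β₃`. [folklore] -/
theorem trans_T :
    PrW D p (evT (insert s(x, m) K) a b c) = PrW D p (evT K a b c) +
      PrW D p (evU₁ K a b c ∩ evT (insert s(x, m) K) a b c) +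
      PrW D p (evU₂ K a b c ∩ evT (insert s(x, m) K) a b c) +
      PrW D p (evU₃ K a b c ∩ evT (insert s(x, m) K) a b c) := by
  refine PrW_of_ind_add4 D p fun S _ => ?_
  by_cases h : S ∈ evT (insert s(x, m) K) a b c
  · obtain ⟨hab1, hac1⟩ := h
    have hT : S ∈ evT (insert s(x, m) K) a b c := ⟨hab1, hac1⟩
    rw [ind_of_mem hT]
    by_cases hab0 : R K S a b
    · by_cases hac0 : R K S a c
      · rw [ind_of_mem (show S ∈ evT K a b c from ⟨hab0, hac0⟩),
          ind_of_not_mem (fun h : S ∈ evU₁ K a b c ∩ evT _ a b c => h.1.2 hac0),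
          ind_of_not_mem (fun h : S ∈ evU₂ K a b c ∩ evT _ a b c => h.1.2 hab0),
          ind_of_not_mem (fun h : S ∈ evU₃ K a b c ∩ evT _ a b c => h.1.2 hab0)]; ring
      · rw [ind_of_not_mem (fun h : S ∈ evT K a b c => hac0 h.2),
          ind_of_mem (show S ∈ evU₁ K a b c ∩ evT _ a b c from ⟨⟨hab0, hac0⟩, hT⟩),
          ind_of_not_mem (fun h : S ∈ evU₂ K a b c ∩ evT _ a b c => h.1.2 hab0),
          ind_of_not_mem (fun h : S ∈ evU₃ K a b c ∩ evT _ a b c => h.1.2 hab0)]; ring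
    · by_cases hac0 : R K S a c
      · rw [ind_of_not_mem (fun h : S ∈ evT K a b c => hab0 h.1),
          ind_of_not_mem (fun h : S ∈ evU₁ K a b c ∩ evT _ a b c => hab0 h.1.1),
          ind_of_mem (show S ∈ evU₂ K a b c ∩ evT _ a b c from ⟨⟨hac0, hab0⟩, hT⟩),
          ind_of_not_mem (fun h : S ∈ evU₃ K a b c ∩ evT _ a b c => hab0 (hac0.trans h.1.1.symm))]
        ring
      · have hbc0 : R K S b c := gain_both (hax S) hab1 hab0 hac1 hac0
        rw [ind_of_not_mem (fun h : S ∈ evT K a b c => hab0 h.1),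
          ind_of_not_mem (fun h : S ∈ evU₁ K a b c ∩ evT _ a b c => hab0 h.1.1),
          ind_of_not_mem (fun h : S ∈ evU₂ K a b c ∩ evT _ a b c => hac0 h.1.1),
          ind_of_mem (show S ∈ evU₃ K a b c ∩ evT _ a b c from ⟨⟨hbc0, hab0⟩, hT⟩)]; ring
  · rw [ind_of_not_mem h, ind_of_not_mem (fun h' : S ∈ evU₁ K a b c ∩ evT _ a b c => h h'.2),
      ind_of_not_mem (fun h' : S ∈ evU₂ K a b c ∩ evT _ a b c => h h'.2),
      ind_of_not_mem (fun h' : S ∈ evU₃ K a b c ∩ evT _ a b c => h h'.2)]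
    have : S ∉ evT K a b c := fun h' => h ⟨R_mono_insert _ h'.1, R_mono_insert _ h'.2⟩
    rw [ind_of_not_mem this]; ring

end Transitions


end CubicThreePointStep

end Summit.CriticalPhenomena.PercolationContinuityZ3.Theorems
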